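import Summits.ValiantsHypothesis.ValiantsHypothesis.Theorems.GrenetZeonDualUnipotentThreeHalvesHeavyTopBand

/-!
# `GrenetZeon.DualUnipotentThreeHalves` (stmt-ValiantsHypothesis-24318) — line «radical_split» §8, NEGATIVE lane:
# THE INDEX-SPARSITY KILL — a pencil whose every large direction space carries a top of high nil-index is not flag-cheap,
# hence refutes `HeavyTopInst n m` at its format (booking lemma for the WAVE-2 REFUTE programme)

Booking lemma of the Negative lane asked for by val-idea-crit-7 g0's VERDICT #7 (card `Cruxes/DualUnipotentThreeHalves/Ideas/dense-irreducible.md`,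
val-idea-29 g0, lens (d) REFUTE; «(b) typed generic kill … LAND via port-2»), in the PENCIL form of the card's First lemma
(`IndexSparse n m N` written inline, def-free); this file val-port-2 g2 (24318 instrument / Negative lane, director R277 (e)).

* `exists_indexCheap_of_flagCheap` — «flag-cheap ⇒ index-cheap» in the line's own currency: `FlagCheap n m N` (affine `N`) gives a
  direction space `K` and a budget `k` with `(k+1)·n < dim K`, `k + 2 ≤ n` and `N_lin(v)^{k+1} = 0` for every `v ∈ K`
  (✓ `flagCheap_iff_wordTame` + ✓ `pow_eq_zero_of_wordTame`; the refuter's form of ✓ p613488 `linPart_pow_eq_zero_of_flagCheap`).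
* ★ `not_flagCheap_of_indexSparse` — if EVERY `K` with `(k+1)·n < dim K` contains a direction whose top has `N_lin(v)^{k+1} ≠ 0`
  («`IndexSparse n m N`» of the card), then `¬ FlagCheap n m N`.
* ★ `not_heavyTopInst_of_indexSparse` — the card's kill: an affine nilpotent index-sparse pencil satisfying the heavy-top hypothesis
  refutes `HeavyTopInst n m`; `not_heavyTopInst_of_indexSparse_small` — for `n ≤ 16` the heavy-top hypothesis is automatic
  (`dim K ≤ n² ≤ 16n`), so index-sparsity alone kills the format (this is the shape of ✓ p635270 `(3,5)` and ✓ p648631 `(4,7)`,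
  whose certificates are index/word arguments on explicit far-corner pencils).

Honest framing.  A booking lemma (`--supports stmt-ValiantsHypothesis-24318`, Negative lane): it REFUTES NOTHING by itself — every use
needs an explicit index-sparse pencil at an admissible format; R2 `HeavyTopLaw`, S3b, the crux `DualUnipotentThreeHalves`, rung 8062 and
`VP ≠ VNP` are untouched / NOT proved.  [this line's workfile §8; val-idea-29's card; ✓ `…Negative.FlagCheapIndexBound` (p613488); ✓ `…WordFlagPencil`]
-/

-- `Summit.ValiantsHypothesis.ValiantsHypothesis.…` repeats a component (D-0017 layout); `dupNamespace` would flag the mandated name.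
set_option linter.dupNamespace false
set_option autoImplicit false

noncomputable section

namespace Summit.ValiantsHypothesis.ValiantsHypothesis.Theorems.GrenetZeon.RadicalSplit

open MvPolynomial Matrix
open scoped BigOperators
open Summit.ValiantsHypothesis.ValiantsHypothesis.Cruxes.TwoDimCoefficients.DimTwoCases (AffMat IsAffine)

/-- **Flag-cheap ⇒ index-cheap (line currency).**  If the affine pencil `N` is `FlagCheap n m N`, there are a direction space `K`
and a budget `k` with `(k+1)·n < dim K`, `k + 2 ≤ n`, and `N_lin(v)^{k+1} = 0` for every `v ∈ K`. [✓ p613488, word form] -/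
theorem exists_indexCheap_of_flagCheap {n m : ℕ} (N : AffMat n m) (hN : IsAffine N) (h : FlagCheap n m N) :
    ∃ (K : Submodule ℂ (Fin n × Fin n → ℂ)) (k : ℕ), (k + 1) * n < Module.finrank ℂ K ∧ k + 2 ≤ n ∧
      ∀ v ∈ K, linPart N v ^ (k + 1) = 0 := by
  classical
  rw [flagCheap_iff_wordTame N hN] at h
  obtain ⟨K, k, hdim, hW⟩ := h
  have hK : Module.finrank ℂ K ≤ n * n := by
    have h1 := Submodule.finrank_le K
    rw [Module.finrank_fintype_fun_eq_card, Fintype.card_prod, Fintype.card_fin] at h1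
    exact h1
  have hkn : k + 2 ≤ n := by
    have h2 : (k + 1) * n < n * n := lt_of_lt_of_le hdim hK
    have h3 : k + 1 < n := Nat.lt_of_mul_lt_mul_right h2
    omega
  exact ⟨K, k, hdim, hkn, fun v hv => pow_eq_zero_of_wordTame hkn _ _ (hW 0 v hv)⟩

/-- ★ **THE INDEX-SPARSITY KILL, flag form.**  If every direction space `K` with `(k+1)·n < dim K` contains a direction `v` whose
top has nil-index `> k + 1` (`N_lin(v)^{k+1} ≠ 0`) — the card's `IndexSparse n m N`, written inline — then `N` is not flag-cheap.
[this file] -/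
theorem not_flagCheap_of_indexSparse {n m : ℕ} (N : AffMat n m) (hN : IsAffine N)
    (h : ∀ (K : Submodule ℂ (Fin n × Fin n → ℂ)) (k : ℕ), (k + 1) * n < Module.finrank ℂ K →
      ∃ v ∈ K, linPart N v ^ (k + 1) ≠ 0) :
    ¬ FlagCheap n m N := by
  intro hc
  obtain ⟨K, k, hdim, -, hpow⟩ := exists_indexCheap_of_flagCheap N hN hc
  obtain ⟨v, hv, hne⟩ := h K k hdim
  exact hne (hpow v hv)

/-- ★ **THE INDEX-SPARSITY KILL at a format** (val-idea-29's `not_heavyTopInst_of_indexSparse`, pencil form): an affine nilpotent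
`m × m` pencil over `ℂ^{n×n}` that satisfies R2's heavy-top hypothesis and is index-sparse refutes `HeavyTopInst n m`. [this file] -/
theorem not_heavyTopInst_of_indexSparse {n m : ℕ} (N : AffMat n m) (hN : IsAffine N) (hnil : N ^ m = 0)
    (hheavy : ∀ K : Submodule ℂ (Fin n × Fin n → ℂ), RadOrth n m N K →
      Module.finrank ℂ K ≤ 16 * m * Nat.sqrt n + 16 * n)
    (h : ∀ (K : Submodule ℂ (Fin n × Fin n → ℂ)) (k : ℕ), (k + 1) * n < Module.finrank ℂ K →
      ∃ v ∈ K, linPart N v ^ (k + 1) ≠ 0) :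
    ¬ HeavyTopInst n m :=
  fun hInst => not_flagCheap_of_indexSparse N hN h (hInst N hN hnil hheavy)

/-- **Small formats**: for `n ≤ 16` (more generally `n·n ≤ 16·m·⌊√n⌋ + 16·n`) the heavy-top hypothesis of R2 is automatic
(`dim K ≤ n² `), so an index-sparse affine nilpotent pencil alone refutes `HeavyTopInst n m` — the shape of the `(3,5)` and `(4,7)`
far-corner verdicts (✓ `not_heavyTopInst_three_five`, ✓ `not_heavyTopInst_four_seven`). [this file] -/
theorem not_heavyTopInst_of_indexSparse_small {n m : ℕ} (hsmall : n * n ≤ 16 * m * Nat.sqrt n + 16 * n)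
    (N : AffMat n m) (hN : IsAffine N) (hnil : N ^ m = 0)
    (h : ∀ (K : Submodule ℂ (Fin n × Fin n → ℂ)) (k : ℕ), (k + 1) * n < Module.finrank ℂ K →
      ∃ v ∈ K, linPart N v ^ (k + 1) ≠ 0) :
    ¬ HeavyTopInst n m := by
  refine not_heavyTopInst_of_indexSparse N hN hnil (fun K _ => ?_) h
  have h1 := Submodule.finrank_le K
  rw [Module.finrank_fintype_fun_eq_card, Fintype.card_prod, Fintype.card_fin] at h1
  exact h1.trans hsmall

/-- For `n ≤ 16` the smallness condition holds at every `m` (`n² ≤ 16 n`). [bookkeeping] -/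
theorem small_of_le_sixteen {n m : ℕ} (hn : n ≤ 16) : n * n ≤ 16 * m * Nat.sqrt n + 16 * n := by
  have h1 : n * n ≤ 16 * n := Nat.mul_le_mul_right n hn
  have h2 : 16 * n ≤ 16 * m * Nat.sqrt n + 16 * n := Nat.le_add_left _ _
  exact h1.trans h2

end Summit.ValiantsHypothesis.ValiantsHypothesis.Theorems.GrenetZeon.RadicalSplit

end
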